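import Summits.ResolutionOfSingularities.ResolutionOfSingularities.Theorems.PurelyInseparableDim4ResConeResidue
import HarnessLib
import HarnessLib.Audit.Tags

/-!
# Purely inseparable four-folds — THE SHADE OF A TRAP IS AT MOST `(3p − 4)/2`: the located residue of K2(p)
# shrinks to `1 ≤ d`, `2d + 4 ≤ 3p`, `2 ≤ e_G ≤ 4` (every prime)

[OURS · counted 0 · cell `res-dim4-pi` · seat res-dim4-p-12 g2 · K2(p) lane (desk WORD #66 (2)).]  Nothing
here proves K2(p), `NoIsolatedTrap p p` or resolution of singularities in dimension ≥ 4 / characteristic `p`.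

After the first step of a band chain the boundary is never empty (`1 ≤ |r′|`: the new exceptional letter
carries `r′_j = o − p ≥ 1`, `one_le_degree_step_r`), so on a constant-shade-`d` chain every order from index `1`
on is `≥ d + 1`; the two-consecutive-orders kill of `…BandLayers` (`no_isolated_chain_of_orders`, free-tail
lemma + three-layer non-isolation: `3p ≤ o_k + o_{k+1} + 1` is fatal) then forces `2d + 3 < 3p`
(`two_mul_shade_add_four_le`).  Hence **`noAboveFloorTrap_iff_noLocatedTrap'`**: K2(p) iff no isolated
above-floor `Step0 p` chain with `x^{r₀} ∣ F₀`, constant shade `d` with `1 ≤ d` and `2d + 4 ≤ 3p`, and constant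
`e_G = e ∈ [2, 4]`.  At `p = 5`: `d ∈ {1, …, 5}` (was `≤ 8`); at `p = 7`: `d ≤ 8` (was `≤ 12`).
bears_on: LADDER-RESOLUTION:D157-DOOR2 (res-dim4-pi · K2(p)).  Supports stmt-ResolutionOfSingularities-16155
(helper).
-/

set_option linter.dupNamespace false -- mandated namespace of this single-conjunct summit

noncomputable section

namespace Summit.ResolutionOfSingularities.ResolutionOfSingularities.Theorems.PIDim4

namespace ResCone

open MvPolynomial Finset
open Literature.AlgebraicGeometry.Resolution
open Literature.AlgebraicGeometry.Resolution.CentreBlowup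
open Literature.AlgebraicGeometry.Resolution.Hauser2010
open Literature.AlgebraicGeometry.Resolution.HauserPerlega2019

variable {K : Type} [Field K]

/-- **After a band step the boundary is non-empty**: `1 ≤ |r′|` (indeed `r′_j = o − q ≥ 1`). [folklore] -/
theorem one_le_degree_step_r [DecidableEq K] (q : ℕ) (j : Fin 4) {b : Fin 4 → K} (hbj : b j = 0)
    (s : State K) {o : ℕ} (ho : ordZero s.F = o) (hr : ∀ d ∈ s.F.support, s.r ≤ d) (hqo : q < o) :
    1 ≤ (CentreBlowup.step q Finset.univ j b s).r.degree := by
  rw [step_r_univ q j hbj s ho hr]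
  have h := Finsupp.le_degree j ((s.r.filter (fun i => b i = 0)).update j (o - q))
  rw [Finsupp.update_apply, if_pos rfl] at h
  omega

/-- Along an isolated above-floor chain the boundary is non-empty from index `1` on. [folklore] -/
theorem one_le_degree_r_succ (p : ℕ) [Fact p.Prime] [DecidableEq K] {c : ℕ → State K}
    (hc : ∀ k, IsIsolated p (c k).F ∧ Step0 p (c k) (c (k + 1)))
    (hr0 : ∀ e ∈ (c 0).F.support, (c 0).r ≤ e) (hfloor : ∀ k, ordZero (c k).F ≠ p) (k : ℕ) :
    1 ≤ (c (k + 1)).r.degree := by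
  obtain ⟨j, b, hw⟩ := FreeTail.exists_witnesses (K := K) (fun k => (hc k).2)
  obtain ⟨o, ho, hpo, -⟩ := BandShade.exists_ordZero_eq p hc k
  have hpo' : p < o := lt_of_le_of_ne hpo (fun h => hfloor k (by rw [ho, h]))
  obtain ⟨-, hbk, -, -, hck⟩ := hw k
  rw [hck]
  exact one_le_degree_step_r p (j k) hbk (c k) ho (IsolatedBand.isolated_chain_forall_le hc hr0 k) hpo'

/-- **THE SHADE OF A TRAP IS AT MOST `(3p − 4)/2`**: along an isolated above-floor `Step0 p` chain with
`x^{r₀} ∣ F₀` and constant natural shade `d`, `2d + 4 ≤ 3p` (orders `≥ d + 1` twice in a row with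
`2(d + 1) + 1 ≥ 3p` are fatal by `BandLayers.no_isolated_chain_of_orders`). [OURS] [folklore] -/
theorem two_mul_shade_add_four_le (p : ℕ) [Fact p.Prime] [CharP K p] [DecidableEq K] {c : ℕ → State K}
    (hc : ∀ k, IsIsolated p (c k).F ∧ Step0 p (c k) (c (k + 1)))
    (hr0 : ∀ e ∈ (c 0).F.support, (c 0).r ≤ e) (hfloor : ∀ k, ordZero (c k).F ≠ p) {d : ℕ}
    (hshade : ∀ k, (c k).shade = (d : ℕ∞)) : 2 * d + 4 ≤ 3 * p := by
  by_contra hlt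
  have hc' : ∀ k, IsIsolated p (c (k + 1)).F ∧ Step0 p (c (k + 1)) (c (k + 1 + 1)) := fun k => hc (k + 1)
  refine BandLayers.no_isolated_chain_of_orders p hc' (fun _ => d + 1) (fun k => ?_) (fun _ => by omega)
  obtain ⟨o, ho, -, -⟩ := BandShade.exists_ordZero_eq p hc (k + 1)
  have hr1 := one_le_degree_r_succ p hc hr0 hfloor k
  have hsh := hshade (k + 1)
  rw [BandShade.shade_eq_coe ho] at hsh
  have hd : o - (c (k + 1)).r.degree = d := by exact_mod_cast hsh
  have hro := degree_r_le ho (IsolatedBand.isolated_chain_forall_le hc hr0 (k + 1))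
  rw [ho]
  exact_mod_cast (show d + 1 ≤ o by omega)

/-- **K2(p) ⟺ NO LOCATED TRAP, sharpened**: as `noAboveFloorTrap_iff_noLocatedTrap` with the shade window
`1 ≤ d`, `2d + 4 ≤ 3p` (instead of `d ≤ 2p − 2`). [OURS] [cite: CossartJannsenSaito2020, Thm. 3.14] -/
theorem noAboveFloorTrap_iff_noLocatedTrap' (p : ℕ) [Fact p.Prime] :
    RidgeBudget.NoAboveFloorTrap p p ↔ ∀ (K : Type) [Field K] [CharP K p] [DecidableEq K],
      ¬ ∃ (c : ℕ → State K) (d e : ℕ), 1 ≤ d ∧ 2 * d + 4 ≤ 3 * p ∧ 2 ≤ e ∧ e ≤ 4 ∧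
        (∀ e' ∈ (c 0).F.support, (c 0).r ≤ e') ∧
        ∀ k, IsIsolated p (c k).F ∧ Step0 p (c k) (c (k + 1)) ∧ ordZero (c k).F ≠ p ∧
          (c k).shade = (d : ℕ∞) ∧ Module.finrank K (resVertex (c k)) = e := by
  rw [noAboveFloorTrap_iff_noLocatedTrap]
  constructor
  · intro h K _ _ _
    rintro ⟨c, d, e, hd1, -, he2, he4, hr0, hc⟩
    have hp : 2 ≤ p := (Fact.out : p.Prime).two_le
    have hbound := two_mul_shade_add_four_le p (fun k => ⟨(hc k).1, (hc k).2.1⟩) hr0 (fun k => (hc k).2.2.1)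
      (fun k => (hc k).2.2.2.1)
    exact h K ⟨c, d, e, hd1, by omega, he2, he4, hr0, hc⟩
  · intro h K _ _ _
    rintro ⟨c, d, e, hd1, -, he2, he4, hr0, hc⟩
    have hbound := two_mul_shade_add_four_le p (fun k => ⟨(hc k).1, (hc k).2.1⟩) hr0 (fun k => (hc k).2.2.1)
      (fun k => (hc k).2.2.2.1)
    exact h K ⟨c, d, e, hd1, hbound, he2, he4, hr0, hc⟩

end ResCone

end Summit.ResolutionOfSingularities.ResolutionOfSingularities.Theorems.PIDim4

end
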